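import Mathlib

/-!
# SoloBlind — sheared boxes cover the straight strip (ENGINE L v0.4, ENGINE-L-SPEC §10)

In the propagation band (`Re x ≲ -6`) engine L uses SHEARED boxes
`B = {(x, g) : |g - g_c| ≤ d, ‖x - s(g) · x₀‖ ≤ r}` with `s(g) = g_c² / g² ∈ [s_lo, s_hi]`, because the
resonances of the Jost recurrence are (to leading order) fixed in the variable `√2 g² x`.  The strip
itself is tiled by STRAIGHT column rectangles.  This file proves the covering inequality the driver
uses: if, at the slice `g`, the scaled real part `Re x / s` lies in the column `[a - hx/2, a + hx/2]`
and the physical imaginary part lies in the row `[y₀ - hy/2, y₀ + hy/2]`, then `x` lies in the sheared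
disc centred at `s · (a + i y₀)` of radius `s_hi · hx/2 + hy/2 + |y₀| · max (s_hi - 1) (1 - s_lo)`.
-/

namespace Summit.AnomalousDissipation.SoloBlind.ShearedCover

/-- Elementary: for `s ∈ [s_lo, s_hi]`, `|1 - s| ≤ max (s_hi - 1) (1 - s_lo)`. -/
theorem abs_one_sub_le {s slo shi : ℝ} (hs : slo ≤ s ∧ s ≤ shi) :
    |1 - s| ≤ max (shi - 1) (1 - slo) := by
  rcases le_or_gt s 1 with h | h
  · rw [abs_of_nonneg (by linarith)]
    exact le_max_of_le_right (by linarith [hs.1])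
  · rw [abs_of_neg (by linarith)]
    exact le_max_of_le_left (by linarith [hs.2])

/-- SHEARED COVER.  A point of the straight strip whose `g`-scaled real part lies in the column of
half-width `hx/2` around `a` and whose imaginary part lies in the row of half-width `hy/2` around `y₀`
belongs to the sheared disc of the box centred at `a + i y₀`. -/
theorem sheared_cover {x : ℂ} {a y₀ s slo shi hx hy : ℝ} (hs : slo ≤ s ∧ s ≤ shi) (hslo : 0 < slo)
    (hhx : 0 ≤ hx) (hre : |x.re / s - a| ≤ hx / 2) (him : |x.im - y₀| ≤ hy / 2) :
    ‖x - (s : ℂ) * ((a : ℂ) + (y₀ : ℂ) * Complex.I)‖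
      ≤ shi * (hx / 2) + hy / 2 + |y₀| * max (shi - 1) (1 - slo) := by
  have hs0 : 0 < s := lt_of_lt_of_le hslo hs.1
  set z : ℂ := x - (s : ℂ) * ((a : ℂ) + (y₀ : ℂ) * Complex.I) with hz
  have hzre : z.re = s * (x.re / s - a) := by
    rw [hz]; simp; field_simp
  have hzim : z.im = (x.im - y₀) + y₀ * (1 - s) := by
    rw [hz]; simp; ring
  have h1 : |z.re| ≤ shi * (hx / 2) := by
    rw [hzre, abs_mul, abs_of_pos hs0]
    calc s * |x.re / s - a| ≤ s * (hx / 2) := mul_le_mul_of_nonneg_left hre hs0.le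
      _ ≤ shi * (hx / 2) := mul_le_mul_of_nonneg_right hs.2 (by linarith)
  have h2 : |z.im| ≤ hy / 2 + |y₀| * max (shi - 1) (1 - slo) := by
    rw [hzim]
    calc |x.im - y₀ + y₀ * (1 - s)| ≤ |x.im - y₀| + |y₀ * (1 - s)| := abs_add_le _ _
      _ = |x.im - y₀| + |y₀| * |1 - s| := by rw [abs_mul]
      _ ≤ hy / 2 + |y₀| * max (shi - 1) (1 - slo) :=
          add_le_add him (mul_le_mul_of_nonneg_left (abs_one_sub_le hs) (abs_nonneg _))
  calc ‖z‖ ≤ |z.re| + |z.im| := Complex.norm_le_abs_re_add_abs_im z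
    _ ≤ shi * (hx / 2) + (hy / 2 + |y₀| * max (shi - 1) (1 - slo)) := add_le_add h1 h2
    _ = shi * (hx / 2) + hy / 2 + |y₀| * max (shi - 1) (1 - slo) := by ring

/-- The same statement with the disc written around the scaled complex centre `s · x₀`,
`x₀ = a + i y₀` given by its real and imaginary parts. -/
theorem sheared_cover' {x x₀ : ℂ} {s slo shi hx hy : ℝ} (hs : slo ≤ s ∧ s ≤ shi) (hslo : 0 < slo)
    (hhx : 0 ≤ hx) (hre : |x.re / s - x₀.re| ≤ hx / 2) (him : |x.im - x₀.im| ≤ hy / 2) :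
    ‖x - (s : ℂ) * x₀‖ ≤ shi * (hx / 2) + hy / 2 + |x₀.im| * max (shi - 1) (1 - slo) := by
  have h := sheared_cover (x := x) (a := x₀.re) (y₀ := x₀.im) hs hslo hhx hre him
  have hx0 : ((x₀.re : ℂ) + (x₀.im : ℂ) * Complex.I) = x₀ := Complex.re_add_im x₀
  rw [hx0] at h
  exact h

end Summit.AnomalousDissipation.SoloBlind.ShearedCover
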